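import Literature.NumberTheory.Weil1965.AdelicSiegelFibreMeasureSplitPlace
import HarnessLib

/-!
# The Eisenstein fibre measure at a split place, WEIGHTED form: `∫ f(z) φ(y) d(e_* μ_b) = c(φ) · ∫ f dμ_{b',v}`

Topic `NumberTheory/Weil1965`; namespace `Literature.NumberTheory.Weil1965`.  KERNEL mathematics only (theorems; no definition,
no named fact, no `axiom`, no `sorry`).  Sequel of ★ `AdelicSiegelFibreMeasureSplitPlace` (rectangles `A × B`).

The SW2 I-CLOSE outer assembly tests `𝟙_A ⊗ φ` with WEIGHTS `φ ≥ 0` on the complementary factor `Y` (Weil's «mesure tempérée»,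
[Weil1965, Chap. V n° 51, p. 73]) rather than rectangles `𝟙_A ⊗ 𝟙_B` (`Y` contains the archimedean factor, whose indicators are not
Schwartz).  For the Eisenstein fibre measure `μ_b` (★ `adelicSiegelFibreMeasure`) transported along a split-place chart
`e : X ≃ (K^κ × K^κ) × Y` (letter (BRIDGE-v): the `v`-adic isometries act by `(x, y) ↦ (g x, g⁻ᵀ y)` and the fibre `h = b` lands in
the max-rank split locus `S_{b'} × Y`), the `φ`-weighted `X_v`-marginal `A ↦ ∫ 𝟙_A(z) φ(y) d(e_* μ_b)(z, y)` is again a multiple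
`c(φ) · μ_{b',v}` of the local fibre measure:

  `∫⁻ f(z) φ(y) d(e_* μ_b)(z, y) = c(φ) · ∫⁻ f dμ_{b',v}`   (`exists_lintegral_mul_weight_map_adelicSiegelFibreMeasure_eq_mul_fibreMeasure`)

— Lemme 22 (★ `SplitPlace.exists_lintegral_fst_mul_indicator_snd_eq_mul_fibreMeasure`) applied to `(e_* μ_b).withDensity (φ ∘ snd)`
and `B = Y`, fed by the full push-forward invariance `(g, g⁻ᵀ) × id)_* e_* μ_b = e_* μ_b` (★ `map_adelicSiegelFibreMeasure_eq`,
`map_splitAct_map_adelicSiegelFibreMeasure_eq`) and `(e_* μ_b)(S_{b'}ᶜ × Y) = 0` (★ `fibreMeasure_compl`).  The one hypothesis on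
`φ` — `∫_{C × Y} φ d(e_* μ_b) < ∞` for compact `C` — is DISCHARGED for bounded `φ` vanishing off a relatively compact set (`…_of_bdd`,
via the rectangle file) and for `φ` dominated on each `e⁻¹(C × Y)` by a nonnegative Schwartz–Bruhat function of `X` (`…_of_schwartzBruhat`,
temperedness of `μ_b ≤ E_X`: ★ `integral_adelicSiegelMeasure_le_of_nonneg`) — the case of Schwartz weights `φ ∈ 𝒮_ℝ(Y)`.  Set form
(`…indicator…`) and REAL (Bochner) form (`exists_integral_mul_weight_map_adelicSiegelFibreMeasure_eq_mul_integral_fibreMeasure`) included.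

Cell `hodgecm-mathlib`, FLOOR 0, crux H413 (stmt-HodgeConjecture-24833), E-2 ∕ SW2 I-CLOSE sheet `SW2-ICLOSE-ASSEMBLY.v0` c78afe1b §1 (E-FAC),
ruling «WEIGHTS» (F0P4-plan (g4) 2026-08-31 03:36:58Z).  HC_CM is proved only modulo the 7 printed citations until rung 0 closes; this file
is unconditional.

## References
* [Weil1965] A. Weil, *Sur la formule de Siegel dans la théorie des groupes classiques*, Acta Math. 113 (1965): Chap. IV n° 41
  (35) p. 59, n° 46 p. 66; Chap. V n° 49 Lemme 22 p. 70, n° 51 p. 73.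
-/

set_option autoImplicit false

noncomputable section

open MeasureTheory Filter Topology Set NumberField IsDedekindDomain
open scoped NNReal ENNReal Matrix Classical
open Literature.NumberTheory.Automorphic
open Literature.NumberTheory.Weil1964
open Literature.NumberTheory.GaloisRepresentations.IsNonarchimedeanLocalField

namespace Literature.NumberTheory.Weil1965

section HelpersW
variable {K : Type*} [Field K] [ValuativeRel K] [TopologicalSpace K] [IsNonarchimedeanLocalField K]

/-- instance helper: `K` is second countable. [folklore] -/
private theorem secondCountable_K' : SecondCountableTopology K := secondCountableTopology_localField K

/-- instance helper: `K` is Hausdorff. [folklore] -/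
private theorem t2_K' : T2Space K :=
  (Literature.NumberTheory.GaloisRepresentations.IsNonarchimedeanLocalField.isLocalField K).toT2Space

end HelpersW

variable (F : Type) [Field F] [NumberField F] (ι : Type) [Fintype ι]
  [MeasurableSpace (adeleQuotient F)] [BorelSpace (adeleQuotient F)]
  [MeasurableSpace (AdeleRing (𝓞 F) F)] [BorelSpace (AdeleRing (𝓞 F) F)]
  (μ : Measure (ι → AdeleRing (𝓞 F) F)) [μ.IsAddHaarMeasure]
  (h : (ι → AdeleRing (𝓞 F) F) → AdeleRing (𝓞 F) F) (hh : Continuous h)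
  (hB : ∀ Φ ∈ piSchwartzBruhat F ι, Summable fun ξ : F => ‖adelicSiegelCoeff F ι μ h Φ ξ‖)
  {K : Type*} [Field K] [ValuativeRel K] [TopologicalSpace K] [IsNonarchimedeanLocalField K]
  [MeasurableSpace K] [BorelSpace K] [MeasurableSingletonClass K] (μK : Measure K) [μK.IsAddHaarMeasure]
  {κ : Type*} [Fintype κ] [Nonempty κ] [DecidableEq κ] (hκ : 2 ≤ Fintype.card κ)
  {Y : Type*} [TopologicalSpace Y] [T2Space Y] [MeasurableSpace Y] [BorelSpace Y] [SecondCountableTopology Y]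
  (e : (ι → AdeleRing (𝓞 F) F) ≃ₜ ((κ → K) × (κ → K)) × Y)
  (b : F) (b' : K)
  (hfib : ∀ x, h x = algebraMap F (AdeleRing (𝓞 F) F) b →
    (e x).1.1 ⬝ᵥ (e x).1.2 = b' ∧ (e x).1.1 ≠ 0 ∧ (e x).1.2 ≠ 0)
  (T : GL κ K → ((ι → AdeleRing (𝓞 F) F) ≃ₜ (ι → AdeleRing (𝓞 F) F)))
  (hTμ : ∀ g, MeasurePreserving (T g) μ μ) (hTh : ∀ g x, h (T g x) = h x)
  (hTS : ∀ g, ∀ Φ ∈ piSchwartzBruhat F ι, Φ ∘ T g ∈ piSchwartzBruhat F ι)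
  (hTe : ∀ g x, e (T g x) =
    ((((g : Matrix κ κ K) *ᵥ (e x).1.1, ((g⁻¹ : GL κ K) : Matrix κ κ K)ᵀ *ᵥ (e x).1.2) : (κ → K) × (κ → K)), (e x).2))


section Weighted

omit [MeasurableSingletonClass K] [Nonempty κ] [T2Space Y] in
include hTμ hTh hTS hTe in
/-- the transported fibre measure `e_* μ_b` is invariant under `((x, y), w) ↦ ((g x, g⁻ᵀ y), w)`, `g ∈ GL_κ(K)` — the full push-forward
form of the invariance ★ `map_adelicSiegelFibreMeasure_eq` read through the chart `e`. [cite: Weil1965, Chap. IV n° 46, p. 66] -/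
theorem map_splitAct_map_adelicSiegelFibreMeasure_eq (g : GL κ K) :
    (((adelicSiegelFibreMeasure F ι μ h hh hB b).map e).map fun z : ((κ → K) × (κ → K)) × Y =>
        (((((g : Matrix κ κ K) *ᵥ z.1.1, ((g⁻¹ : GL κ K) : Matrix κ κ K)ᵀ *ᵥ z.1.2) : (κ → K) × (κ → K))), z.2)) =
      (adelicSiegelFibreMeasure F ι μ h hh hB b).map e := by
  haveI : SecondCountableTopology K := secondCountable_K'
  haveI : T2Space K := t2_K'
  haveI := secondCountableTopology_adeleRing (K := F)
  haveI : BorelSpace (ι → AdeleRing (𝓞 F) F) := Pi.borelSpace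
  haveI : BorelSpace (κ → K) := Pi.borelSpace
  haveI : BorelSpace ((κ → K) × (κ → K)) := Prod.borelSpace
  haveI : BorelSpace (((κ → K) × (κ → K)) × Y) := Prod.borelSpace
  set GG : ((κ → K) × (κ → K)) × Y → ((κ → K) × (κ → K)) × Y := fun z =>
    (((((g : Matrix κ κ K) *ᵥ z.1.1, ((g⁻¹ : GL κ K) : Matrix κ κ K)ᵀ *ᵥ z.1.2) : (κ → K) × (κ → K))), z.2) with hGG
  have hGGm : Measurable GG :=
    (((continuous_const.matrix_mulVec (continuous_fst.comp continuous_fst)).prodMk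
      (continuous_const.matrix_mulVec (continuous_snd.comp continuous_fst))).prodMk continuous_snd).measurable
  have hem : Measurable e := e.continuous.measurable
  have hcomp : GG ∘ e = e ∘ T g := funext fun x => (hTe g x).symm
  rw [Measure.map_map hGGm hem, hcomp, ← Measure.map_map hem (T g).continuous.measurable,
    (map_adelicSiegelFibreMeasure_eq hh hB (T g) (hTμ g) (hTh g) (hTS g) b).2]

omit [MeasurableSingletonClass K] [Nonempty κ] [DecidableEq κ] [T2Space Y] in
include hfib in
/-- `e_* μ_b` gives no mass to `S_{b'}ᶜ × Y` (carried by the max-rank split locus; ★ `fibreMeasure_compl` + `hfib`).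
[cite: Weil1965, Chap. IV n° 41 (35), p. 59] -/
theorem map_adelicSiegelFibreMeasure_compl_splitLocus_prod_univ :
    ((adelicSiegelFibreMeasure F ι μ h hh hB b).map e)
        ({z : (κ → K) × (κ → K) | z.1 ⬝ᵥ z.2 = b' ∧ z.1 ≠ 0 ∧ z.2 ≠ 0}ᶜ ×ˢ (univ : Set Y)) = 0 := by
  haveI : SecondCountableTopology K := secondCountable_K'
  haveI : T2Space K := t2_K'
  haveI := secondCountableTopology_adeleRing (K := F)
  haveI : BorelSpace (ι → AdeleRing (𝓞 F) F) := Pi.borelSpace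
  haveI : BorelSpace (κ → K) := Pi.borelSpace
  haveI : BorelSpace ((κ → K) × (κ → K)) := Prod.borelSpace
  haveI : BorelSpace (((κ → K) × (κ → K)) × Y) := Prod.borelSpace
  have hem : Measurable e := e.continuous.measurable
  have hsub : e ⁻¹' ({z : (κ → K) × (κ → K) | z.1 ⬝ᵥ z.2 = b' ∧ z.1 ≠ 0 ∧ z.2 ≠ 0}ᶜ ×ˢ (univ : Set Y)) ⊆
      (h ⁻¹' {algebraMap F (AdeleRing (𝓞 F) F) b})ᶜ := by
    intro x hx hxb
    simp only [mem_preimage, mem_prod, mem_compl_iff, mem_setOf_eq] at hx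
    exact hx.1 (hfib x hxb)
  have hSm : MeasurableSet ({z : (κ → K) × (κ → K) | z.1 ⬝ᵥ z.2 = b' ∧ z.1 ≠ 0 ∧ z.2 ≠ 0}ᶜ ×ˢ (univ : Set Y)) := by
    refine MeasurableSet.prod (MeasurableSet.compl ?_) MeasurableSet.univ
    have h1 : MeasurableSet {z : (κ → K) × (κ → K) | z.1 ⬝ᵥ z.2 = b'} :=
      (isClosed_eq (continuous_fst.dotProduct continuous_snd) continuous_const).measurableSet
    have h2 : MeasurableSet {z : (κ → K) × (κ → K) | z.1 ≠ 0} :=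
      (isClosed_eq continuous_fst continuous_const).measurableSet.compl
    have h3 : MeasurableSet {z : (κ → K) × (κ → K) | z.2 ≠ 0} :=
      (isClosed_eq continuous_snd continuous_const).measurableSet.compl
    simpa only [setOf_and] using h1.inter (h2.inter h3)
  rw [Measure.map_apply hem hSm]
  exact measure_mono_null hsub (fibreMeasure_compl F ι _ _ h hh b)

omit [T2Space Y] in
include hfib hTμ hTh hTS hTe in
/-- **(E-FAC), WEIGHTED — `∫ f(z) φ(y) d(e_* μ_b) = c(φ) · ∫ f dμ_{b',v}`**: for every Borel weight `φ ≥ 0` on `Y` with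
`∫_{C × Y} φ d(e_* μ_b) < ∞` on compacts `C ⊆ K^κ × K^κ` there is `c(φ) ≥ 0` with `∫⁻ f(z) φ(y) d(e_* μ_b)(z, y) = c(φ) · ∫⁻ f dμ_{b',v}`
for every Borel `f ≥ 0` — Lemme 22 for the `φ`-weighted marginal (Weil's tempered-measure form of n° 51).
[cite: Weil1965, Chap. V n° 49 Lemma 22, p. 70; n° 51, p. 73] -/
theorem exists_lintegral_mul_weight_map_adelicSiegelFibreMeasure_eq_mul_fibreMeasure (φ : Y → ℝ≥0∞) (hφm : Measurable φ)
    (hφ : ∀ C : Set ((κ → K) × (κ → K)), IsCompact C →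
      ∫⁻ z in C ×ˢ (univ : Set Y), φ z.2 ∂((adelicSiegelFibreMeasure F ι μ h hh hB b).map e) < ⊤) :
    ∃ c : ℝ≥0, ∀ f : (κ → K) × (κ → K) → ℝ≥0∞, Measurable f →
      ∫⁻ z, f z.1 * φ z.2 ∂((adelicSiegelFibreMeasure F ι μ h hh hB b).map e) =
        c * ∫⁻ z, f z ∂(SplitPlace.fibreMeasure μK hκ b') := by
  haveI : SecondCountableTopology K := secondCountable_K'
  haveI : T2Space K := t2_K'
  haveI := secondCountableTopology_adeleRing (K := F)
  haveI : BorelSpace (ι → AdeleRing (𝓞 F) F) := Pi.borelSpace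
  haveI : BorelSpace (κ → K) := Pi.borelSpace
  haveI : BorelSpace ((κ → K) × (κ → K)) := Prod.borelSpace
  haveI : BorelSpace (((κ → K) × (κ → K)) × Y) := Prod.borelSpace
  set ν := (adelicSiegelFibreMeasure F ι μ h hh hB b).map e with hν
  have hdens : Measurable fun z : ((κ → K) × (κ → K)) × Y => φ z.2 := hφm.comp measurable_snd
  set νφ := ν.withDensity (fun z => φ z.2) with hνφ
  have hνφs : ∀ s, MeasurableSet s → νφ s = ∫⁻ z in s, φ z.2 ∂ν := fun s hs => withDensity_apply _ hs
  -- (i) finite on `C × Y`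
  have h1 : ∀ C : Set ((κ → K) × (κ → K)), IsCompact C → νφ (C ×ˢ (univ : Set Y)) < ⊤ := fun C hC => by
    rw [hνφs _ (hC.measurableSet.prod MeasurableSet.univ)]
    exact hφ C hC
  -- (ii) `GL_κ(K)`-invariance on `A × Y`
  have h2 : ∀ (g : GL κ K) (A : Set ((κ → K) × (κ → K))), MeasurableSet A →
      νφ (((fun z => (((g : Matrix κ κ K) *ᵥ z.1, ((g⁻¹ : GL κ K) : Matrix κ κ K)ᵀ *ᵥ z.2) : (κ → K) × (κ → K))) ⁻¹' A) ×ˢ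
        (univ : Set Y)) = νφ (A ×ˢ (univ : Set Y)) := by
    intro g A hA
    set G : (κ → K) × (κ → K) → (κ → K) × (κ → K) := fun z =>
      (((g : Matrix κ κ K) *ᵥ z.1, ((g⁻¹ : GL κ K) : Matrix κ κ K)ᵀ *ᵥ z.2) : (κ → K) × (κ → K)) with hG
    set GG : ((κ → K) × (κ → K)) × Y → ((κ → K) × (κ → K)) × Y := fun z => (G z.1, z.2) with hGG
    have hGm : Measurable G :=
      ((continuous_const.matrix_mulVec continuous_fst).prodMk (continuous_const.matrix_mulVec continuous_snd)).measurable
    have hGGm : Measurable GG := (hGm.comp measurable_fst).prodMk measurable_snd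
    have hpre : (G ⁻¹' A) ×ˢ (univ : Set Y) = GG ⁻¹' (A ×ˢ (univ : Set Y)) := by
      ext z; simp only [mem_prod, mem_preimage, mem_univ, and_true, hGG]
    have hAU : MeasurableSet (A ×ˢ (univ : Set Y)) := hA.prod MeasurableSet.univ
    rw [hνφs _ ((hGm hA).prod MeasurableSet.univ), hνφs _ hAU, hpre, ← lintegral_indicator (hGGm hAU),
      ← lintegral_indicator hAU]
    have hind : (fun z => (GG ⁻¹' (A ×ˢ (univ : Set Y))).indicator (fun z : ((κ → K) × (κ → K)) × Y => φ z.2) z) =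
        fun z => ((A ×ˢ (univ : Set Y)).indicator (fun z : ((κ → K) × (κ → K)) × Y => φ z.2)) (GG z) := by
      funext z
      simp only [indicator, mem_preimage, hGG]
    have hGGν : ν.map GG = ν := by
      simpa only [hν, hGG, hG] using
        map_splitAct_map_adelicSiegelFibreMeasure_eq F ι μ h hh hB e b T hTμ hTh hTS hTe g
    rw [hind, ← lintegral_map ((hdens).indicator hAU) hGGm, hGGν]
  -- (iii) carried by `S_{b'} × Y`
  have h3 : νφ ({z : (κ → K) × (κ → K) | z.1 ⬝ᵥ z.2 = b' ∧ z.1 ≠ 0 ∧ z.2 ≠ 0}ᶜ ×ˢ (univ : Set Y)) = 0 :=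
    withDensity_absolutelyContinuous _ _
      (map_adelicSiegelFibreMeasure_compl_splitLocus_prod_univ F ι μ h hh hB e b b' hfib)
  obtain ⟨c, hc⟩ := SplitPlace.exists_lintegral_fst_mul_indicator_snd_eq_mul_fibreMeasure μK hκ b' νφ MeasurableSet.univ
    h1 h2 h3
  refine ⟨c, fun f hf => ?_⟩
  have key := hc f hf
  simp only [indicator_univ, Pi.one_apply, mul_one] at key
  rw [← key, hνφ]
  refine Eq.trans ?_ (lintegral_withDensity_eq_lintegral_mul ν hdens
    (show Measurable fun p : ((κ → K) × (κ → K)) × Y => f p.1 from hf.comp measurable_fst)).symm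
  refine lintegral_congr fun z => ?_
  simp only [Pi.mul_apply, mul_comm]

omit [T2Space Y] in
include hfib hTμ hTh hTS hTe in
/-- (E-FAC), weighted, on sets: `∫ 𝟙_A(z) φ(y) d(e_* μ_b) = c(φ) · μ_{b',v}(A)` for every Borel `A`.
[cite: Weil1965, Chap. V n° 49 Lemma 22, p. 70; n° 51, p. 73] -/
theorem exists_lintegral_indicator_mul_weight_map_adelicSiegelFibreMeasure_eq_mul_fibreMeasure (φ : Y → ℝ≥0∞)
    (hφm : Measurable φ)
    (hφ : ∀ C : Set ((κ → K) × (κ → K)), IsCompact C →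
      ∫⁻ z in C ×ˢ (univ : Set Y), φ z.2 ∂((adelicSiegelFibreMeasure F ι μ h hh hB b).map e) < ⊤) :
    ∃ c : ℝ≥0, ∀ A : Set ((κ → K) × (κ → K)), MeasurableSet A →
      ∫⁻ z, A.indicator 1 z.1 * φ z.2 ∂((adelicSiegelFibreMeasure F ι μ h hh hB b).map e) =
        c * SplitPlace.fibreMeasure μK hκ b' A := by
  obtain ⟨c, hc⟩ := exists_lintegral_mul_weight_map_adelicSiegelFibreMeasure_eq_mul_fibreMeasure F ι μ h hh hB μK hκ e b b'
    hfib T hTμ hTh hTS hTe φ hφm hφ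
  refine ⟨c, fun A hA => ?_⟩
  rw [hc (A.indicator 1) (measurable_one.indicator hA), lintegral_indicator_one hA]

include hfib hTμ hTh hTS hTe in
/-- the finiteness hypothesis DISCHARGED for a bounded weight with relatively compact support: `φ ≤ M`, `φ = 0` off `B`,
`closure B` compact ⇒ weighted (E-FAC). [cite: Weil1965, Chap. V n° 49 Lemma 22, p. 70] -/
theorem exists_lintegral_mul_weight_map_adelicSiegelFibreMeasure_eq_mul_fibreMeasure_of_bdd (φ : Y → ℝ≥0∞)
    (hφm : Measurable φ) {M : ℝ≥0} (hφM : ∀ y, φ y ≤ M) {B : Set Y} (hφB : ∀ y, φ y ≠ 0 → y ∈ B)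
    (hBc : IsCompact (closure B)) :
    ∃ c : ℝ≥0, ∀ f : (κ → K) × (κ → K) → ℝ≥0∞, Measurable f →
      ∫⁻ z, f z.1 * φ z.2 ∂((adelicSiegelFibreMeasure F ι μ h hh hB b).map e) =
        c * ∫⁻ z, f z ∂(SplitPlace.fibreMeasure μK hκ b') := by
  haveI : SecondCountableTopology K := secondCountable_K'
  haveI : T2Space K := t2_K'
  haveI := secondCountableTopology_adeleRing (K := F)
  haveI : BorelSpace (ι → AdeleRing (𝓞 F) F) := Pi.borelSpace
  haveI : BorelSpace (κ → K) := Pi.borelSpace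
  haveI : BorelSpace ((κ → K) × (κ → K)) := Prod.borelSpace
  haveI : BorelSpace (((κ → K) × (κ → K)) × Y) := Prod.borelSpace
  refine exists_lintegral_mul_weight_map_adelicSiegelFibreMeasure_eq_mul_fibreMeasure F ι μ h hh hB μK hκ e b b' hfib T hTμ
    hTh hTS hTe φ hφm fun C hC => ?_
  set ν := (adelicSiegelFibreMeasure F ι μ h hh hB b).map e with hν
  have hfinC : ν (C ×ˢ closure B) < ⊤ := by
    have := (map_adelicSiegelFibreMeasure_lemme22_hypotheses F ι μ h hh hB e b b' hfib T hTμ hTh hTS hTe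
      (B := closure B) isClosed_closure.measurableSet (by simpa only [closure_closure] using hBc)).1 C hC
    simpa only [hν] using this
  have hle : ∀ z : ((κ → K) × (κ → K)) × Y, (C ×ˢ (univ : Set Y)).indicator (fun z => φ z.2) z ≤
      (C ×ˢ closure B).indicator (fun _ => (M : ℝ≥0∞)) z := by
    intro z
    by_cases hz : z ∈ C ×ˢ closure B
    · rw [indicator_of_mem hz]
      exact (indicator_le_self _ _ z).trans (hφM z.2)
    · rw [indicator_of_notMem hz]
      refine le_of_eq ?_
      by_cases hzC : z ∈ C ×ˢ (univ : Set Y)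
      · rw [indicator_of_mem hzC]
        by_contra hne
        exact hz ⟨hzC.1, subset_closure (hφB z.2 hne)⟩
      · exact indicator_of_notMem hzC _
  calc ∫⁻ z in C ×ˢ (univ : Set Y), φ z.2 ∂ν
      = ∫⁻ z, (C ×ˢ (univ : Set Y)).indicator (fun z => φ z.2) z ∂ν :=
        (lintegral_indicator (hC.measurableSet.prod MeasurableSet.univ) _).symm
    _ ≤ ∫⁻ z, (C ×ˢ closure B).indicator (fun _ => (M : ℝ≥0∞)) z ∂ν := lintegral_mono hle
    _ = M * ν (C ×ˢ closure B) := lintegral_indicator_const (hC.measurableSet.prod isClosed_closure.measurableSet) _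
    _ < ⊤ := ENNReal.mul_lt_top ENNReal.coe_lt_top hfinC

omit [T2Space Y] in
include hfib hTμ hTh hTS hTe in
/-- the finiteness hypothesis DISCHARGED by TEMPEREDNESS of `μ_b ≤ E_X` (★ `integral_adelicSiegelMeasure_le_of_nonneg`): if on each
`e⁻¹(C × Y)`, `C` compact, the weight `φ(y)` is dominated by a nonnegative Schwartz–Bruhat function `Ψ_C` of `X`, then weighted
(E-FAC) holds — the case of Schwartz weights `φ ∈ 𝒮_ℝ(Y)` (take `Ψ_C = e^*(𝟙_{C'} ⊗ φ)`, `C' ⊇ C` compact open).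
[cite: Weil1965, Chap. V n° 49 Lemma 22, p. 70; n° 51, p. 73] -/
theorem exists_lintegral_mul_weight_map_adelicSiegelFibreMeasure_eq_mul_fibreMeasure_of_schwartzBruhat (φ : Y → ℝ≥0∞)
    (hφm : Measurable φ)
    (hdom : ∀ C : Set ((κ → K) × (κ → K)), IsCompact C → ∃ Ψ : piSchwartzBruhatReal F ι,
      0 ≤ (Ψ : (ι → AdeleRing (𝓞 F) F) → ℝ) ∧
        ∀ x, (e x).1 ∈ C → φ (e x).2 ≤ ENNReal.ofReal ((Ψ : (ι → AdeleRing (𝓞 F) F) → ℝ) x)) :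
    ∃ c : ℝ≥0, ∀ f : (κ → K) × (κ → K) → ℝ≥0∞, Measurable f →
      ∫⁻ z, f z.1 * φ z.2 ∂((adelicSiegelFibreMeasure F ι μ h hh hB b).map e) =
        c * ∫⁻ z, f z ∂(SplitPlace.fibreMeasure μK hκ b') := by
  haveI : SecondCountableTopology K := secondCountable_K'
  haveI : T2Space K := t2_K'
  haveI := secondCountableTopology_adeleRing (K := F)
  haveI : BorelSpace (ι → AdeleRing (𝓞 F) F) := Pi.borelSpace
  haveI : BorelSpace (κ → K) := Pi.borelSpace
  haveI : BorelSpace ((κ → K) × (κ → K)) := Prod.borelSpace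
  haveI : BorelSpace (((κ → K) × (κ → K)) × Y) := Prod.borelSpace
  refine exists_lintegral_mul_weight_map_adelicSiegelFibreMeasure_eq_mul_fibreMeasure F ι μ h hh hB μK hκ e b b' hfib T hTμ
    hTh hTS hTe φ hφm fun C hC => ?_
  obtain ⟨Ψ, hΨ0, hΨ⟩ := hdom C hC
  set μb := adelicSiegelFibreMeasure F ι μ h hh hB b with hμb
  have hem : Measurable e := e.continuous.measurable
  have hCU : MeasurableSet (C ×ˢ (univ : Set Y)) := hC.measurableSet.prod MeasurableSet.univ
  -- integrability of `Ψ` against `μ_b ≤ E_X`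
  have hint : Integrable (Ψ : (ι → AdeleRing (𝓞 F) F) → ℝ) μb :=
    (integral_adelicSiegelMeasure_le_of_nonneg (μ := μ) hh hB Ψ hΨ0).1.mono_measure (fibreMeasure_le F ι _ _ h b)
  have hdomx : ∀ x, (C ×ˢ (univ : Set Y)).indicator (fun z : ((κ → K) × (κ → K)) × Y => φ z.2) (e x) ≤
      ‖(Ψ : (ι → AdeleRing (𝓞 F) F) → ℝ) x‖ₑ := by
    intro x
    by_cases hx : e x ∈ C ×ˢ (univ : Set Y)
    · rw [indicator_of_mem hx, Real.enorm_eq_ofReal (hΨ0 x)]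
      exact hΨ x hx.1
    · rw [indicator_of_notMem hx]
      exact bot_le
  calc ∫⁻ z in C ×ˢ (univ : Set Y), φ z.2 ∂(μb.map e)
      = ∫⁻ z, (C ×ˢ (univ : Set Y)).indicator (fun z => φ z.2) z ∂(μb.map e) := (lintegral_indicator hCU _).symm
    _ = ∫⁻ x, (C ×ˢ (univ : Set Y)).indicator (fun z => φ z.2) (e x) ∂μb :=
        lintegral_map ((hφm.comp measurable_snd).indicator hCU) hem
    _ ≤ ∫⁻ x, ‖(Ψ : (ι → AdeleRing (𝓞 F) F) → ℝ) x‖ₑ ∂μb := lintegral_mono hdomx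
    _ < ⊤ := hint.2

omit [T2Space Y] in
include hfib hTμ hTh hTS hTe in
/-- (E-FAC), weighted, REAL form: for a Borel weight `φ : Y → ℝ`, `0 ≤ φ`, with the finiteness hypothesis, there is `c(φ) ≥ 0` with
`∫ f(z) φ(y) d(e_* μ_b) = c(φ) · ∫ f dμ_{b',v}` for every Borel `f ≥ 0` on `K^κ × K^κ` (Bochner integrals; both sides are `0` by
convention when infinite). [cite: Weil1965, Chap. V n° 49 Lemma 22, p. 70; n° 51, p. 73] -/
theorem exists_integral_mul_weight_map_adelicSiegelFibreMeasure_eq_mul_integral_fibreMeasure (φ : Y → ℝ) (hφm : Measurable φ)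
    (hφ0 : ∀ y, 0 ≤ φ y)
    (hφ : ∀ C : Set ((κ → K) × (κ → K)), IsCompact C →
      ∫⁻ z in C ×ˢ (univ : Set Y), ENNReal.ofReal (φ z.2) ∂((adelicSiegelFibreMeasure F ι μ h hh hB b).map e) < ⊤) :
    ∃ c : ℝ≥0, ∀ f : (κ → K) × (κ → K) → ℝ, Measurable f → (∀ z, 0 ≤ f z) →
      ∫ z, f z.1 * φ z.2 ∂((adelicSiegelFibreMeasure F ι μ h hh hB b).map e) =
        c * ∫ z, f z ∂(SplitPlace.fibreMeasure μK hκ b') := by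
  haveI : SecondCountableTopology K := secondCountable_K'
  haveI : T2Space K := t2_K'
  haveI : BorelSpace (κ → K) := Pi.borelSpace
  haveI : BorelSpace ((κ → K) × (κ → K)) := Prod.borelSpace
  haveI : BorelSpace (((κ → K) × (κ → K)) × Y) := Prod.borelSpace
  obtain ⟨c, hc⟩ := exists_lintegral_mul_weight_map_adelicSiegelFibreMeasure_eq_mul_fibreMeasure F ι μ h hh hB μK hκ e b b'
    hfib T hTμ hTh hTS hTe (fun y => ENNReal.ofReal (φ y)) (by fun_prop) hφ
  refine ⟨c, fun f hf hf0 => ?_⟩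
  set ν := (adelicSiegelFibreMeasure F ι μ h hh hB b).map e with hν
  have hF : Measurable fun z : ((κ → K) × (κ → K)) × Y => f z.1 * φ z.2 :=
    (hf.comp measurable_fst).mul (hφm.comp measurable_snd)
  have hI1 := integral_eq_lintegral_of_nonneg_ae (μ := ν) (f := fun z : ((κ → K) × (κ → K)) × Y => f z.1 * φ z.2)
    (Eventually.of_forall fun z => mul_nonneg (hf0 z.1) (hφ0 z.2)) hF.aestronglyMeasurable
  have hI2 := integral_eq_lintegral_of_nonneg_ae (μ := SplitPlace.fibreMeasure μK hκ b') (f := f)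
    (Eventually.of_forall fun z => hf0 z) hf.aestronglyMeasurable
  rw [hI1, hI2]
  have hofReal : (fun z : ((κ → K) × (κ → K)) × Y => ENNReal.ofReal (f z.1 * φ z.2)) =
      fun z => ENNReal.ofReal (f z.1) * ENNReal.ofReal (φ z.2) := by
    funext z; exact ENNReal.ofReal_mul (hf0 z.1)
  rw [hofReal, hc (fun x => ENNReal.ofReal (f x)) (by fun_prop), ENNReal.toReal_mul, ENNReal.coe_toReal]

end Weighted

/-! ## ED. 2 — the three hypotheses in the I-CLOSE consumer's shapes

The outer assembly (★ `Theorems/H413E2SWIdentityCloseSplit :: marginal_eq_smul_marginal_of_dilate_bound`, its `μ₂ := e_* μ_b`)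
quantifies `hfin` over compact `L × T`, `hinv` over ALL Borel `A × B`, and `hcar` on `S_{b'}ᶜ × Y`; here they are verbatim. -/

section IdentityCloseShapes

omit [MeasurableSingletonClass K] [Nonempty κ] in
include hfib hTμ hTh hTS hTe in
/-- the EISENSTEIN-SIDE inputs of the I-CLOSE comparison in the consumer's binder shapes: `e_* μ_b` is finite on compact rectangles
`L × T`, invariant on every Borel rectangle under `(x, y) ↦ (g x, g⁻ᵀ y)`, `g ∈ GL_κ(K)`, and carried by `S_{b'} × Y`.
[cite: Weil1965, Chap. IV n° 46, p. 66; n° 41 (35), p. 59] -/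
theorem map_adelicSiegelFibreMeasure_identityClose_hypotheses :
    (∀ (L : Set ((κ → K) × (κ → K))) (B : Set Y), IsCompact L → IsCompact B →
      ((adelicSiegelFibreMeasure F ι μ h hh hB b).map e) (L ×ˢ B) < ⊤) ∧
    (∀ (g : GL κ K) (A : Set ((κ → K) × (κ → K))) (B : Set Y), MeasurableSet A → MeasurableSet B →
      ((adelicSiegelFibreMeasure F ι μ h hh hB b).map e)
        (((fun z => (((g : Matrix κ κ K) *ᵥ z.1, ((g⁻¹ : GL κ K) : Matrix κ κ K)ᵀ *ᵥ z.2) : (κ → K) × (κ → K))) ⁻¹' A) ×ˢ B) =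
      ((adelicSiegelFibreMeasure F ι μ h hh hB b).map e) (A ×ˢ B)) ∧
    ((adelicSiegelFibreMeasure F ι μ h hh hB b).map e)
        ({z : (κ → K) × (κ → K) | z.1 ⬝ᵥ z.2 = b' ∧ z.1 ≠ 0 ∧ z.2 ≠ 0}ᶜ ×ˢ (univ : Set Y)) = 0 := by
  haveI : SecondCountableTopology K := secondCountable_K'
  haveI : T2Space K := t2_K'
  haveI := secondCountableTopology_adeleRing (K := F)
  haveI : BorelSpace (ι → AdeleRing (𝓞 F) F) := Pi.borelSpace
  haveI : BorelSpace (κ → K) := Pi.borelSpace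
  haveI : BorelSpace ((κ → K) × (κ → K)) := Prod.borelSpace
  haveI : BorelSpace (((κ → K) × (κ → K)) × Y) := Prod.borelSpace
  refine ⟨fun L B hL hBc => ?_, fun g A B hA hBm => ?_,
    map_adelicSiegelFibreMeasure_compl_splitLocus_prod_univ F ι μ h hh hB e b b' hfib⟩
  · exact (map_adelicSiegelFibreMeasure_lemme22_hypotheses F ι μ h hh hB e b b' hfib T hTμ hTh hTS hTe
      hBc.isClosed.measurableSet (by simpa only [hBc.isClosed.closure_eq] using hBc)).1 L hL
  · set G : (κ → K) × (κ → K) → (κ → K) × (κ → K) := fun z =>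
      (((g : Matrix κ κ K) *ᵥ z.1, ((g⁻¹ : GL κ K) : Matrix κ κ K)ᵀ *ᵥ z.2) : (κ → K) × (κ → K)) with hG
    set GG : ((κ → K) × (κ → K)) × Y → ((κ → K) × (κ → K)) × Y := fun z => (G z.1, z.2) with hGG
    have hGm : Measurable G :=
      ((continuous_const.matrix_mulVec continuous_fst).prodMk (continuous_const.matrix_mulVec continuous_snd)).measurable
    have hGGm : Measurable GG := (hGm.comp measurable_fst).prodMk measurable_snd
    have hpre : (G ⁻¹' A) ×ˢ B = GG ⁻¹' (A ×ˢ B) := by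
      ext z; simp only [mem_prod, mem_preimage, hGG]
    have hGGν : ((adelicSiegelFibreMeasure F ι μ h hh hB b).map e).map GG = (adelicSiegelFibreMeasure F ι μ h hh hB b).map e := by
      simpa only [hGG, hG] using map_splitAct_map_adelicSiegelFibreMeasure_eq F ι μ h hh hB e b T hTμ hTh hTS hTe g
    rw [hpre, ← Measure.map_apply hGGm (hA.prod hBm), hGGν]

end IdentityCloseShapes

end Literature.NumberTheory.Weil1965

end
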